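import Summits.QuantumFields.BalabanUV.Beta.WardMixedWardModel

/-!
# `BalabanUV.Beta.WardBorderWardModel` — binder row D1, (L4): **AN EXPLICIT TWO-SLOT MODEL OF THE hW BORDER WARD SOCKET** — the leg-to-leg flux
# table `TB` solves BOTH level-0 border Ward letters (W-B₀)∕(W-B₀″) EXACTLY (β sub-cell, D1 formalisation swarm, unit
# `b2b-balaban-beta-d1-formalise-leaf-06`, gen 5; «D1-hRhW-BORDER-JOINT-WARD-MODEL» part D1)

HONEST FRAMING (cell charter, verbatim): «discharging `BetaPertH` makes Bałaban's UV stability UNCONDITIONAL — a real constructive-QFT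
result; it is NOT the continuum limit and NOT the Clay problem.»  HONEST DEPENDENCY (verbatim): «continuum YM on T⁴ ⇐ BetaPertH ∧ nine spine
estimates (0/9 proved); BetaPertH ⇐ (D1) ∧ (D4) ∧ CAP+tail; G-an2-4 gates asym, D1 and NE2/3/4.»  [our object] data definitions (`spath`, `TB`) and
[folklore] lattice-path ∕ Kronecker algebra over an1's node-8ρ rooted stencil Ward law (`AveragingWardRootedStencils.divV_vhSAt_apply`), node 7aρ's
`vhSAt` (class `locStencil_vhSAt`, `vhSAt_symm`, `vhSAt_translate`), the border dictionary `WardLocusStencils.bhKAt_inl_inr_eq_linSymAt` with an2's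
`decays_bhKAt`, and part C1's path indicator `WardMixedWardModel.pathInd` BY NAME.  No statement of Bałaban's papers, no `[cite:]`, no
`def … : Prop`; `TB` is a MODEL of a typed socket, NOT Bałaban's second-order border averaging jet (an1's `vh₂SAn1` remains the row's letter for the
literal of record); instantiates NO binder of the β-function wall (0/4: hW, hR, D1Tel, D1Rep).  NOT hW, NOT hR, NOT D1, NOT `BetaPertH`, NOT
continuum, NOT Clay.

WHAT (`d + 1 = 4`, root `ρ`, weight `c′`; at the wall `ρ = ρ_c = toSite (ctrOff 4 Lc)`, `c′ = −Lc⁸∕2`).  The hW END's two level-0 border Ward letters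
(`WardLocusParityLevels.…_TW_su_exact₀`: hBord0 — block divergence in the FIRST jet slot against the datum `[c′ • vhSAt κ′ u′, D_Y]` of the SECOND,
and hBord0″ — the same with the slots exchanged) ask for ONE bi-table solving both.  A root-to-leg flux (part C1's `MW` pattern) solves one slot and
spoils the other by a non-local ribbon term; the LEG-TO-LEG flux does both:
* §1 `spath a b κ u := ½(pathInd a b − pathInd b a) κ u` — the antisymmetrised axial path flux from `a` to `b`; divergence `[b = s] − [a = s]`
  (`spath_div`), `spath b a = −spath a b`, `|spath| ≤ 1`, support `|u − a|₁ ≤ 2|b − a|₁`, translation invariance.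
* §2 **`TB ρ Lc c′ κ u κ′ u′ x z a b := (Lc⁴∕2)·(π_e(κ,u)·V_{κ′u′}(e) + V_{κu}(e)·π_e(κ′,u′) − c′·Q(e)·π_e(κ,u)·π_e(κ′,u′))`**, `e = (x,a;z,b)`,
  `π_e := spath (legSite ρ x a) (legSite ρ z b)` (flux between the two LEG SITES of the entry), `V := c′ • vhSAt ρ 3 Lc`, `Q := mfNeg (linSymAt ρ Lc)`
  (ENTRYWISE the first-order table is a current of charge `Q(e)` from one leg site to the other: `divV_vhSAt_apply`); no `ff`∕`mm` block, border
  ANTI-TWIN (consistent with leaf-04's NO-TWIN theorem `WardBorderNoTwinModel`), slot-swap symmetric.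
* §3 **`divV_TB_apply`** (`div_g (π⊗V + V⊗π − c′Q·π⊗π) = ([q_z = s] − [q_x = s])·V_{κ′u′}`: the two `Q`-terms cancel), hence **`ward_TB`** (hBord0 with
  residual `0`, in the spelling of leaf-04's `WardBorderReflectionWallJoint.joint_of_ward_model`) and **`ward_TB''`** (hBord0″).
* §4 block translation `TB_translate` (the END's `hBt`).  The `LocStencil₂` class (the END's `hB`) is the sequel `WardBorderWardModelClass`.
Part D2 (`WardBorderJointModel`) feeds `TB` to `joint_of_ward_model` and closes hR AND hW for the fully-modelled literal with NO letter hypothesis.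
Provenance: D1 formalisation swarm, leaf prover 06 (gen 5), 2026-08-20; no existing file touched.
-/

noncomputable section

open Finset
open scoped BigOperators
open Literature.MathematicalPhysics.QuantumFieldTheory
open Literature.MathematicalPhysics.QuantumFieldTheory.Balaban1983to89
open Literature.MathematicalPhysics.QuantumFieldTheory.Balaban1983to89.Beta
open B12Sec2to5 (l1 l1_nonneg)
open ExpKernelCalculus (MKer BiLoc shiftK l1_sub_triangle l1_sub_symm)
open KernelWard (divV)
open AffineAveraging (Site box toSite unitVec unitVec_apply)
open AveragingContours (blk off)
open AveragingContoursRooted (ctr ctrOff ctrOff_mem_box)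
open AveragingHessianKernels (Bond Bond.sh off_add_smul blk_add_smul packVH_inl_inl packVH_inr_inr)
open AveragingHessianKernelsRooted (vhSAt vhSAt_symm vhSAt_translate locStencil_vhSAt linKerAt_add)
open OneStepResolventKernel (Fib LocStencil)
open OneStepKernelFamily (l1_neg_eq)
open BalabanCompositeJets (LocStencil₂)
open StepJetData (mfNeg mfNeg_inl_inl mfNeg_inl_inr mfNeg_inr_inl mfNeg_inr_inr)
open Summit.QuantumFields.BalabanUV.Beta.TameKernelCalculus
open Summit.QuantumFields.BalabanUV.Beta.ChartConjugation (conjV)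
open Summit.QuantumFields.BalabanUV.Beta.BorderedHessian (diagK conjV_diagK_apply bhKAt decays_bhKAt cBHA cBHA_nonneg)
open Summit.QuantumFields.BalabanUV.Beta.AveragingWardRootedStencils (linSymAt linSymAt_inl_inr linSymAt_inr_inl linSymAt_inl_inl linSymAt_inr_inr
  linSymAt_symm legSite legSite_inl legSite_inr legInd legInd_apply divV_vhSAt_apply)
open Summit.QuantumFields.BalabanUV.Beta.WardLocusStencils (bhKAt_inl_inr_eq_linSymAt bhKAt_inr_inl_eq_linSymAt)
open Summit.QuantumFields.BalabanUV.Beta.WardBorderReflection (unitVec_eq)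
open Summit.QuantumFields.BalabanUV.Beta.WardMixedWardModel (pathInd pathInd_div abs_pathInd_le l1_le_of_pathInd_ne_zero pathInd_add)

namespace Summit.QuantumFields.BalabanUV.Beta.WardBorderWardModel

/-! ## §1 The antisymmetrised axial path flux -/

/-- [our object] **THE ANTISYMMETRISED AXIAL PATH FLUX** from `a` to `b` on the fine bond `(κ, u)`: the average of the axial path `a → b` and the
reversed axial path `b → a` (so that `spath b a = −spath a b`). -/
def spath (a b : Fin (3 + 1) → ℤ) (κ : Fin (3 + 1)) (u : Fin (3 + 1) → ℤ) : ℝ := (pathInd a b κ u - pathInd b a κ u) / 2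

/-- [folklore] **THE DIVERGENCE OF THE FLUX IS `[b = s] − [a = s]`.** -/
theorem spath_div (a b s : Fin (3 + 1) → ℤ) :
    ∑ κ : Fin (3 + 1), (spath a b κ (s - unitVec κ) - spath a b κ s) = (if b = s then 1 else 0) - (if a = s then 1 else 0) := by
  have h1 := pathInd_div a b s
  have h2 := pathInd_div b a s
  have e : ∀ κ : Fin (3 + 1), spath a b κ (s - unitVec κ) - spath a b κ s =
      ((pathInd a b κ (s - unitVec κ) - pathInd a b κ s) - (pathInd b a κ (s - unitVec κ) - pathInd b a κ s)) / 2 := fun κ => by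
    simp only [spath]; ring
  rw [Finset.sum_congr rfl fun κ _ => e κ, ← Finset.sum_div, Finset.sum_sub_distrib, h1, h2]
  ring

/-- [folklore] The flux is antisymmetric in its endpoints. -/
theorem spath_swap (a b : Fin (3 + 1) → ℤ) (κ : Fin (3 + 1)) (u : Fin (3 + 1) → ℤ) : spath b a κ u = -spath a b κ u := by
  simp only [spath]; ring

/-- [folklore] `|spath| ≤ 1`. -/
theorem abs_spath_le (a b : Fin (3 + 1) → ℤ) (κ : Fin (3 + 1)) (u : Fin (3 + 1) → ℤ) : |spath a b κ u| ≤ 1 := by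
  have h1 := abs_pathInd_le a b κ u
  have h2 := abs_pathInd_le b a κ u
  rw [spath, abs_div, abs_two]
  have := abs_sub (pathInd a b κ u) (pathInd b a κ u)
  linarith

/-- [folklore] **THE FLUX STAYS NEAR ITS ENDPOINTS**: `spath a b κ u ≠ 0 → |u − a|₁ ≤ 2|b − a|₁`. -/
theorem l1_le_of_spath_ne_zero {a b : Fin (3 + 1) → ℤ} {κ : Fin (3 + 1)} {u : Fin (3 + 1) → ℤ} (h : spath a b κ u ≠ 0) :
    l1 (u - a) ≤ 2 * l1 (b - a) := by
  have h0 := l1_nonneg (b - a)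
  by_cases hab : pathInd a b κ u = 0
  · have hba : pathInd b a κ u ≠ 0 := by
      intro hba; apply h; simp [spath, hab, hba]
    have h1 := l1_le_of_pathInd_ne_zero hba
    rw [l1_sub_symm a b] at h1
    have h2 := l1_sub_triangle u b a
    linarith
  · have h1 := l1_le_of_pathInd_ne_zero hab
    linarith

/-- [folklore] The flux is translation invariant. -/
theorem spath_add (a b u v : Fin (3 + 1) → ℤ) (κ : Fin (3 + 1)) : spath (a + v) (b + v) κ (u + v) = spath a b κ u := by
  simp only [spath, pathInd_add]

/-! ## §2 The two-slot Ward model `TB` -/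

section Model

variable (ρ : Fin (3 + 1) → ℤ) (Lc : ℕ) (c' : ℝ)

/-- [our object] **THE TWO-SLOT WARD MODEL OF THE BORDER SOCKET**: entry `e = (x,a;z,b)`, leg sites `q_x = legSite ρ x a`, `q_z = legSite ρ z b`,
`π_e := spath q_x q_z`, `V := c′ • vhSAt ρ 3 Lc`, `Q := mfNeg (linSymAt ρ Lc)`:
`TB κ u κ′ u′ (e) := (Lc⁴∕2)·(π_e(κ,u)·V_{κ′u′}(e) + V_{κu}(e)·π_e(κ′,u′) − c′·Q(e)·π_e(κ,u)·π_e(κ′,u′))`. -/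
def TB : Fin (3 + 1) → (Fin (3 + 1) → ℤ) → Fin (3 + 1) → (Fin (3 + 1) → ℤ) → MKer (3 + 1) (Fib 3) :=
  fun κ u κ' u' x z a b =>
    (Lc : ℝ) ^ 4 / 2 *
      (spath (legSite ρ x a) (legSite ρ z b) κ u * (c' * vhSAt ρ 3 Lc rfl κ' u' x z a b) +
        c' * vhSAt ρ 3 Lc rfl κ u x z a b * spath (legSite ρ x a) (legSite ρ z b) κ' u' -
        c' * mfNeg (linSymAt ρ Lc) x z a b * spath (legSite ρ x a) (legSite ρ z b) κ u * spath (legSite ρ x a) (legSite ρ z b) κ' u')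

variable {ρ Lc c'}

/-- [folklore] Entries of `TB` (definitional unfolding). -/
theorem TB_apply (κ : Fin (3 + 1)) (u : Fin (3 + 1) → ℤ) (κ' : Fin (3 + 1)) (u' x z : Fin (3 + 1) → ℤ) (a b : Fib 3) :
    TB ρ Lc c' κ u κ' u' x z a b = (Lc : ℝ) ^ 4 / 2 *
      (spath (legSite ρ x a) (legSite ρ z b) κ u * (c' * vhSAt ρ 3 Lc rfl κ' u' x z a b) +
        c' * vhSAt ρ 3 Lc rfl κ u x z a b * spath (legSite ρ x a) (legSite ρ z b) κ' u' -
        c' * mfNeg (linSymAt ρ Lc) x z a b * spath (legSite ρ x a) (legSite ρ z b) κ u * spath (legSite ρ x a) (legSite ρ z b) κ' u') := rfl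

/-- [folklore] **`TB` IS SLOT-SWAP SYMMETRIC.** -/
theorem TB_swap (κ : Fin (3 + 1)) (u : Fin (3 + 1) → ℤ) (κ' : Fin (3 + 1)) (u' : Fin (3 + 1) → ℤ) :
    TB ρ Lc c' κ' u' κ u = TB ρ Lc c' κ u κ' u' := by
  funext x z a b
  rw [TB_apply, TB_apply]
  ring

/-- [folklore] `TB` has no field–field block. -/
theorem TB_inl_inl (κ : Fin (3 + 1)) (u : Fin (3 + 1) → ℤ) (κ' : Fin (3 + 1)) (u' x z : Fin (3 + 1) → ℤ) (β β' : Fin (3 + 1)) :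
    TB ρ Lc c' κ u κ' u' x z (Sum.inl β) (Sum.inl β') = 0 := by
  rw [TB_apply]
  simp only [AveragingHessianKernelsRooted.vhSAt, packVH_inl_inl, mfNeg_inl_inl, linSymAt_inl_inl, mul_zero, zero_mul, add_zero, sub_zero]

/-- [folklore] `TB` has no multiplier–multiplier block. -/
theorem TB_inr_inr (κ : Fin (3 + 1)) (u : Fin (3 + 1) → ℤ) (κ' : Fin (3 + 1)) (u' x z : Fin (3 + 1) → ℤ) (m m' : Fin (3 + 1)) :
    TB ρ Lc c' κ u κ' u' x z (Sum.inr m) (Sum.inr m') = 0 := by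
  rw [TB_apply]
  simp only [AveragingHessianKernelsRooted.vhSAt, packVH_inr_inr, mfNeg_inr_inr, linSymAt_inr_inr, mul_zero, zero_mul, add_zero, sub_zero]

/-- [folklore] **`TB` IS BORDER ANTI-TWIN** (`vhSAt` symmetric, `mfNeg (linSymAt ρ)` antisymmetric on the border, `π_{ē} = −π_e`). -/
theorem TB_antiTwin (κ : Fin (3 + 1)) (u : Fin (3 + 1) → ℤ) (κ' : Fin (3 + 1)) (u' x z : Fin (3 + 1) → ℤ) (β m : Fin (3 + 1)) :
    TB ρ Lc c' κ u κ' u' z x (Sum.inr m) (Sum.inl β) = -TB ρ Lc c' κ u κ' u' x z (Sum.inl β) (Sum.inr m) := by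
  rw [TB_apply, TB_apply, vhSAt_symm ρ Lc κ' u' z x, vhSAt_symm ρ Lc κ u z x, mfNeg_inr_inl, mfNeg_inl_inr, linSymAt_symm ρ Lc z x,
    spath_swap (legSite ρ x (Sum.inl β)) (legSite ρ z (Sum.inr m)) κ, spath_swap (legSite ρ x (Sum.inl β)) (legSite ρ z (Sum.inr m)) κ']
  ring

end Model

/-! ## §3 The Ward laws of `TB` in both slots -/

section Law

variable {ρ : Fin (3 + 1) → ℤ} {Lc : ℕ} {c' : ℝ}

/-- [folklore] **THE FIRST-SLOT DIVERGENCE OF `TB`, EVERY ENTRY AND EVERY SITE**: `divV (κ u ↦ TB κ u κ′ u′) s (e) = (Lc⁴∕2)·([q_z = s] − [q_x = s])·V_{κ′u′}(e)`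
— the flux term gives `([q_z = s] − [q_x = s])·V′`, the first-order term gives `c′·([q_z = s] − [q_x = s])·Q·π′` by an1's stencil Ward law
`divV_vhSAt_apply`, and the `Q`-term gives exactly its negative. -/
theorem divV_TB_apply (hLc : 1 ≤ Lc) (κ' : Fin (3 + 1)) (u' s x z : Fin (3 + 1) → ℤ) (a b : Fib 3) :
    divV (fun κ u => TB ρ Lc c' κ u κ' u') s x z a b =
      (Lc : ℝ) ^ 4 / 2 * (((if legSite ρ z b = s then (1 : ℝ) else 0) - (if legSite ρ x a = s then (1 : ℝ) else 0)) *
        (c' * vhSAt ρ 3 Lc rfl κ' u' x z a b)) := by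
  have hV := divV_vhSAt_apply (d := 3) (L := Lc) hLc ρ s x z a b
  simp only [KernelWard.divV, Finset.sum_apply, Pi.sub_apply, legInd_apply] at hV
  have hπ := spath_div (legSite ρ x a) (legSite ρ z b) s
  simp only [KernelWard.divV, Finset.sum_apply, Pi.sub_apply, TB_apply, unitVec_eq]
  set V' := c' * vhSAt ρ 3 Lc rfl κ' u' x z a b with hV'
  set π' := spath (legSite ρ x a) (legSite ρ z b) κ' u' with hπ'
  set Q := mfNeg (linSymAt ρ Lc) x z a b with hQ
  have e : ∀ κ : Fin (3 + 1),
      (Lc : ℝ) ^ 4 / 2 * (spath (legSite ρ x a) (legSite ρ z b) κ (s - unitVec κ) * V' +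
          c' * vhSAt ρ 3 Lc rfl κ (s - unitVec κ) x z a b * π' -
          c' * Q * spath (legSite ρ x a) (legSite ρ z b) κ (s - unitVec κ) * π') -
        (Lc : ℝ) ^ 4 / 2 * (spath (legSite ρ x a) (legSite ρ z b) κ s * V' + c' * vhSAt ρ 3 Lc rfl κ s x z a b * π' -
          c' * Q * spath (legSite ρ x a) (legSite ρ z b) κ s * π') =
        (Lc : ℝ) ^ 4 / 2 * (V' - c' * Q * π') * (spath (legSite ρ x a) (legSite ρ z b) κ (s - unitVec κ) - spath (legSite ρ x a) (legSite ρ z b) κ s) +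
          (Lc : ℝ) ^ 4 / 2 * (c' * π') * (vhSAt ρ 3 Lc rfl κ (s - unitVec κ) x z a b - vhSAt ρ 3 Lc rfl κ s x z a b) := fun κ => by ring
  rw [Finset.sum_congr rfl fun κ _ => e κ, Finset.sum_add_distrib, ← Finset.mul_sum, ← Finset.mul_sum, hπ]
  simp only [unitVec_eq] at hV
  rw [hV]
  ring

/-- [folklore] **`TB` SOLVES THE FIRST-SLOT BORDER WARD LETTER EXACTLY** (hBord0 with residual `0`, in the spelling of leaf-04's `joint_of_ward_model`):
`Lc⁻⁴ • Σ_{v∈box} divV (κ u ↦ 1 • TB κ u κ′ u′) (Lc•Y + v) = [c′ • vhSAt ρ κ′ u′, diagK (½ • Σ_v legInd ρ (Lc•Y + v))]`. -/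
theorem ward_TB (hLc : 1 ≤ Lc) (Y : Fin (3 + 1) → ℤ) (κ' : Fin (3 + 1)) (u' : Fin (3 + 1) → ℤ) :
    (((Lc : ℝ) ^ 4)⁻¹) • ∑ v ∈ box 4 Lc, divV (fun κ u => (1 : ℝ) • TB ρ Lc c' κ u κ' u') ((Lc : ℤ) • Y + toSite v) =
      conjV (c' • vhSAt ρ 3 Lc rfl κ' u') (diagK ((1 / 2 : ℝ) • ∑ v ∈ box 4 Lc, legInd ρ ((Lc : ℤ) • Y + toSite v))) := by
  have hL : (Lc : ℝ) ≠ 0 := by exact_mod_cast (show Lc ≠ 0 by omega)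
  have e1 : (fun κ u => (1 : ℝ) • TB ρ Lc c' κ u κ' u') = fun κ u => TB ρ Lc c' κ u κ' u' := by
    funext κ u; rw [one_smul]
  rw [e1]
  funext x z a b
  rw [Pi.smul_apply, Pi.smul_apply, Pi.smul_apply, Pi.smul_apply, smul_eq_mul, Finset.sum_apply, Finset.sum_apply, Finset.sum_apply,
    Finset.sum_apply, conjV_diagK_apply]
  simp only [divV_TB_apply hLc, Pi.smul_apply, Finset.sum_apply, smul_eq_mul, legInd_apply]
  rw [← Finset.mul_sum, ← Finset.sum_mul, Finset.sum_sub_distrib]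
  field_simp

/-- [folklore] **`TB` SOLVES THE SECOND-SLOT BORDER WARD LETTER EXACTLY** (hBord0″ with residual `0`), by slot-swap symmetry. -/
theorem ward_TB'' (hLc : 1 ≤ Lc) (Y : Fin (3 + 1) → ℤ) (κ : Fin (3 + 1)) (u : Fin (3 + 1) → ℤ) :
    (((Lc : ℝ) ^ 4)⁻¹) • ∑ v ∈ box 4 Lc, divV (fun κ' u' => (1 : ℝ) • TB ρ Lc c' κ u κ' u') ((Lc : ℤ) • Y + toSite v) =
      conjV (c' • vhSAt ρ 3 Lc rfl κ u) (diagK ((1 / 2 : ℝ) • ∑ v ∈ box 4 Lc, legInd ρ ((Lc : ℤ) • Y + toSite v))) := by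
  have e : (fun κ' u' => (1 : ℝ) • TB ρ Lc c' κ u κ' u') = fun κ' u' => (1 : ℝ) • TB ρ Lc c' κ' u' κ u := by
    funext κ' u'; rw [TB_swap]
  rw [e]
  exact ward_TB hLc Y κ u

end Law

/-! ## §4 Block translation -/

section Translate

variable {ρ : Fin (3 + 1) → ℤ} {Lc : ℕ} {c' : ℝ}

/-- [folklore] The leg site moves with the kernel index. -/
theorem legSite_add (ρ x v : Fin (3 + 1) → ℤ) (a : Fib 3) : legSite ρ (x + v) a = legSite ρ x a + v := by
  rcases a with β | m
  · rfl
  · simp only [legSite_inr]; abel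

/-- [folklore] The entry flux is invariant under a common translation of the kernel indices and the bond. -/
theorem spath_legSite_translate (ρ x z u v : Fin (3 + 1) → ℤ) (a b : Fib 3) (κ : Fin (3 + 1)) :
    spath (legSite ρ x a) (legSite ρ z b) κ (u + v) = spath (legSite ρ (x + -v) a) (legSite ρ (z + -v) b) κ u := by
  have hx : legSite ρ x a = legSite ρ (x + -v) a + v := by rw [← legSite_add]; congr 1; abel
  have hz : legSite ρ z b = legSite ρ (z + -v) b + v := by rw [← legSite_add]; congr 1; abel
  rw [hx, hz, spath_add]

/-- [folklore] an1's packed rooted first-order kernel is block-translation invariant (`off_add_smul`, `blk_add_smul`, `linKerAt_add`). -/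
theorem linSymAt_add_zsmul (hLc : 1 ≤ Lc) (x z t : Fin (3 + 1) → ℤ) (a b : Fib 3) :
    linSymAt ρ Lc (x + (Lc : ℤ) • t) (z + (Lc : ℤ) • t) a b = linSymAt ρ Lc x z a b := by
  rcases a with β | m <;> rcases b with β' | m'
  · rfl
  · rw [linSymAt_inl_inr, linSymAt_inl_inr, off_add_smul, blk_add_smul hLc]
    have e := linKerAt_add ρ Lc m' (blk Lc z) t (β, x)
    rw [show Bond.sh ((β, x) : Bond (3 + 1)) ((Lc : ℤ) • t) = (β, x + (Lc : ℤ) • t) from rfl] at e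
    rw [e]
  · rw [linSymAt_inr_inl, linSymAt_inr_inl, off_add_smul, blk_add_smul hLc]
    have e := linKerAt_add ρ Lc m (blk Lc x) t (β', z)
    rw [show Bond.sh ((β', z) : Bond (3 + 1)) ((Lc : ℤ) • t) = (β', z + (Lc : ℤ) • t) from rfl] at e
    rw [e]
  · rfl

/-- [folklore] The charge kernel `Q = mfNeg (linSymAt ρ Lc)` read at translated indices. -/
theorem mfNeg_linSymAt_translate (hLc : 1 ≤ Lc) (x z t : Fin (3 + 1) → ℤ) (a b : Fib 3) :
    mfNeg (linSymAt ρ Lc) x z a b = mfNeg (linSymAt ρ Lc) (x + -((Lc : ℤ) • t)) (z + -((Lc : ℤ) • t)) a b := by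
  have e := linSymAt_add_zsmul (ρ := ρ) hLc (x + -((Lc : ℤ) • t)) (z + -((Lc : ℤ) • t)) t
  simp only [neg_add_cancel_right] at e
  rcases a with β | m <;> rcases b with β' | m' <;>
    simp only [mfNeg_inl_inl, mfNeg_inl_inr, mfNeg_inr_inl, mfNeg_inr_inr, e]

/-- [folklore] **`TB` IS BLOCK-TRANSLATION COVARIANT** (the END's `hBt`). -/
theorem TB_translate (hLc : 1 ≤ Lc) (κ : Fin (3 + 1)) (u : Fin (3 + 1) → ℤ) (κ' : Fin (3 + 1)) (u' t : Fin (3 + 1) → ℤ) :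
    TB ρ Lc c' κ (u + (Lc : ℤ) • t) κ' (u' + (Lc : ℤ) • t) = shiftK (-((Lc : ℤ) • t)) (TB ρ Lc c' κ u κ' u') := by
  funext x z a b
  have h1 := congrFun (congrFun (congrFun (congrFun (vhSAt_translate ρ (d := 3) hLc κ u t) x) z) a) b
  have h2 := congrFun (congrFun (congrFun (congrFun (vhSAt_translate ρ (d := 3) hLc κ' u' t) x) z) a) b
  simp only [ExpKernelCalculus.shiftK] at h1 h2 ⊢
  rw [TB_apply, TB_apply, h1, h2, spath_legSite_translate ρ x z u, spath_legSite_translate ρ x z u',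
    mfNeg_linSymAt_translate hLc x z t]

end Translate

end Summit.QuantumFields.BalabanUV.Beta.WardBorderWardModel

end
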